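import Summits.RiemannHypothesis.RiemannHypothesis.Theorems.JensenPolynomialsCapCertRows
import Summits.RiemannHypothesis.RiemannHypothesis.Theorems.JensenSignTestBlueprint

/-!
# Route `JensenPolynomials` — `XiCumulantMajorantCap` kernel packaging, part 6: weights and SOUNDNESS of `capCheck`

RH-FREE, γ-FREE proof-of-data for the numeric route child `XiCumulantMajorantCap` (stmt-RiemannHypothesis-19217) of
route `JensenPolynomials` (rung J-P(P1′), cell rh-jensen, engine target ET1 «C2GEN-CERT»). Nothing here bears on the truth of RH.
`W₁(j) ≤ W₁⁺(j)/ONE` (`1 ≤ j ≤ d`), `W₁(j) ≤ Wmax⁺/ONE` (`j ≥ 7`), `g = √(2d)/(√(2d+1)+1) ≤ g⁺/ONE`, the term identities,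
and the assembly **`capCheck_sound : capCheck d = true → S₁(d) < 1 ∧ S₂(d) < 1`** with the two sums written exactly as in
the route item `XiCumulantMajorantCap` (Theses/JensenPolynomials.lean); `capCheckRange_sound` for ranges.
-/

-- D-0017: `Summit.RiemannHypothesis.RiemannHypothesis.…` duplicates the namespace BY DESIGN (single-problem summit).
set_option linter.dupNamespace false

namespace Summit.RiemannHypothesis.RiemannHypothesis.Theorems.JensenPolynomials.CapCert

open Finset Real
open Summit.RiemannHypothesis.RiemannHypothesis.Theorems.JensenPolynomials
/-- **Row-by-row domination `W₁(j) ≤ W₁⁺(j)/ONE` for `1 ≤ j ≤ d`.** -/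
theorem W1r_le {d : ℕ} (hd : 3 ≤ d) {j : ℕ} (hj1 : 1 ≤ j) (hjd : j ≤ d) :
    W1r d j ≤ (W1U d (sqdU d) (r3U d) j : ℝ) / ONE := by
  have hd0 : 0 < d := by omega
  unfold W1U
  by_cases hj1' : j ≤ 1
  · -- j = 1 : ρ = 0
    have : j = 1 := by omega
    subst this
    rw [if_pos le_rfl]
    unfold W1r rhoWinMin rhoHT
    simp
  rw [if_neg hj1']
  by_cases hj2 : j = 2
  · subst hj2; rw [if_pos rfl, (W1r_low_rows hd).1, div_self ONE_facts.2.1]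
  rw [if_neg hj2]
  by_cases hj3 : j = 3
  · subst hj3; rw [if_pos rfl]
    have hsq := (W1r_low_rows hd).2.1
    have h0 := (W1r_nonneg hd (by norm_num : 1 ≤ 3)).1
    rw [← Real.sqrt_sq h0, hsq]
    unfold r3U
    apply sqrtU_ge
    have := ofRatU_ge (4 * d - 2) d hd0
    push_cast [Nat.cast_sub (by omega : 2 ≤ 4 * d)] at this
    exact this
  rw [if_neg hj3]
  by_cases hj4 : j = 4
  · subst hj4; rw [if_pos rfl, (W1r_low_rows hd).2.2 (by omega)]; push_cast; rw [mul_div_assoc, div_self ONE_facts.2.1, mul_one]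
  rw [if_neg hj4]
  have hj5 : 5 ≤ j := by omega
  -- generic facts for j ≥ 5
  have henergy : (d.descFactorial j : ℝ) * rhoHT d j / lam d ^ j ≤ (mulU (sqdU d) (sqrtTangU (PU d j)) : ℝ) / ONE := by
    rw [energy_eq hd hj5 hjd]; exact sqrt_dP_le hd hj1
  have hl : 0 < lam d ^ j := pow_pos ((lam_facts hd).1) _
  unfold W1r rhoWinMin
  rw [if_neg (by omega : ¬ j ≤ 4)]
  by_cases h5 : j = 5 ∧ 8 ≤ d
  · rw [if_pos h5, if_pos h5]
    obtain ⟨rfl, h8⟩ := h5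
    have hD : 0 ≤ (d.descFactorial 5 : ℝ) := Nat.cast_nonneg _
    rw [Nat.cast_min, ← min_div_div_right ONE_facts.1.le]
    apply le_min
    · calc (d.descFactorial 5 : ℝ) * min (rhoHT d 5) (bndRow5 d / (2 * (d : ℝ)) ^ (((5:ℕ) : ℝ) / 2)) / lam d ^ 5
          ≤ (d.descFactorial 5 : ℝ) * rhoHT d 5 / lam d ^ 5 :=
            div_le_div_of_nonneg_right (mul_le_mul_of_nonneg_left (min_le_left _ _) hD) hl.le
        _ ≤ _ := henergy
    · calc (d.descFactorial 5 : ℝ) * min (rhoHT d 5) (bndRow5 d / (2 * (d : ℝ)) ^ (((5:ℕ) : ℝ) / 2)) / lam d ^ 5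
          ≤ (d.descFactorial 5 : ℝ) * (bndRow5 d / (2 * (d : ℝ)) ^ (((5:ℕ) : ℝ) / 2)) / lam d ^ 5 :=
            div_le_div_of_nonneg_right (mul_le_mul_of_nonneg_left (min_le_right _ _) hD) hl.le
        _ = (4 * (d : ℝ) + 10) / d := boundRow5_eq h8
        _ ≤ _ := by
            have := ofRatU_ge (4 * d + 10) d hd0
            push_cast at this
            exact this
  rw [if_neg h5, if_neg h5]
  by_cases h6 : j = 6 ∧ 9 ≤ d
  · rw [if_pos h6, if_pos h6]
    obtain ⟨rfl, h9⟩ := h6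
    have hD : 0 ≤ (d.descFactorial 6 : ℝ) := Nat.cast_nonneg _
    rw [Nat.cast_min, ← min_div_div_right ONE_facts.1.le]
    apply le_min
    · calc (d.descFactorial 6 : ℝ) * min (rhoHT d 6) (bndRow6 d / (2 * (d : ℝ)) ^ (((6:ℕ) : ℝ) / 2)) / lam d ^ 6
          ≤ (d.descFactorial 6 : ℝ) * rhoHT d 6 / lam d ^ 6 :=
            div_le_div_of_nonneg_right (mul_le_mul_of_nonneg_left (min_le_left _ _) hD) hl.le
        _ ≤ _ := henergy
    · calc (d.descFactorial 6 : ℝ) * min (rhoHT d 6) (bndRow6 d / (2 * (d : ℝ)) ^ (((6:ℕ) : ℝ) / 2)) / lam d ^ 6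
          ≤ (d.descFactorial 6 : ℝ) * (bndRow6 d / (2 * (d : ℝ)) ^ (((6:ℕ) : ℝ) / 2)) / lam d ^ 6 :=
            div_le_div_of_nonneg_right (mul_le_mul_of_nonneg_left (min_le_right _ _) hD) hl.le
        _ = (5 * (d : ℝ) ^ 2 + 30 * d + 8) / (d : ℝ) ^ 2 := boundRow6_eq h9
        _ ≤ _ := by
            have := ofRatU_ge (5 * d ^ 2 + 30 * d + 8) (d ^ 2) (by positivity)
            push_cast at this
            exact this
  rw [if_neg h6, if_neg h6]
  by_cases hw : 4 * (j - 2) ^ 3 ≤ d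
  · rw [if_pos hw, if_pos hw, window_eq d j hd]
    have hc := div_le_cdiv (6 * (j - 1) * PU d j) 5 (by norm_num)
    rw [le_div_iff₀ ONE_facts.1]
    refine le_trans ?_ hc
    have hP := Pr_le_PU hd0 j hj1
    have hP' : Pr d j * ONE ≤ (PU d j : ℝ) := by rwa [le_div_iff₀ ONE_facts.1] at hP
    have hjR : (0 : ℝ) ≤ (j : ℝ) - 1 := by
      have : (1 : ℝ) ≤ j := by exact_mod_cast hj1
      linarith
    push_cast [Nat.cast_sub hj1]
    rw [le_div_iff₀ (by norm_num : (0:ℝ) < 5)]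
    nlinarith
  · rw [if_neg hw, if_neg hw]
    exact henergy

/-- For `j ≥ 7`: `W₁(j) ≤ Wmax⁺/ONE = max((6/5)(d−1), √d)⁺/ONE`. -/
theorem W1r_le_max {d : ℕ} (hd : 3 ≤ d) {j : ℕ} (hj : 7 ≤ j) (hjd : j ≤ d) :
    W1r d j ≤ (WmaxOf d (sqdU d) : ℝ) / ONE := by
  have hd0 : 0 < d := by omega
  unfold WmaxOf W1r rhoWinMin
  rw [if_neg (by omega : ¬ j ≤ 4), if_neg (by omega : ¬ (j = 5 ∧ 8 ≤ d)), if_neg (by omega : ¬ (j = 6 ∧ 9 ≤ d)),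
    Nat.cast_max]
  by_cases hw : 4 * (j - 2) ^ 3 ≤ d
  · rw [if_pos hw, window_eq d j hd]
    refine le_trans ?_ (div_le_div_of_nonneg_right (le_max_left _ _) ONE_facts.1.le)
    have hc := div_le_cdiv (6 * (d - 1) * ONE) 5 (by norm_num)
    rw [le_div_iff₀ ONE_facts.1]
    refine le_trans ?_ hc
    push_cast [Nat.cast_sub (by omega : 1 ≤ d)]
    rw [le_div_iff₀ (by norm_num : (0:ℝ) < 5)]
    have hP1 := (Pr_facts hd0 j).2
    have hP0 := (Pr_facts hd0 j).1
    have hjd' : (j : ℝ) - 1 ≤ (d : ℝ) - 1 := by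
      have : (j : ℝ) ≤ d := by exact_mod_cast hjd
      linarith
    have hj0 : (0 : ℝ) ≤ (j : ℝ) - 1 := by
      have : (7 : ℝ) ≤ j := by exact_mod_cast hj
      linarith
    have hO := ONE_facts.1.le
    have : ((j : ℝ) - 1) * Pr d j ≤ (d : ℝ) - 1 := by nlinarith
    nlinarith
  · rw [if_neg hw, energy_eq hd (by omega) hjd]
    refine le_trans ?_ (div_le_div_of_nonneg_right (le_max_right _ _) ONE_facts.1.le)
    unfold sqdU
    apply sqrtU_ge
    push_cast
    rw [mul_div_assoc, div_self ONE_facts.2.1, mul_one]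
    have := (Pr_facts hd0 j).2
    have := (Pr_facts hd0 j).1
    nlinarith

/-! ### The second sum -/

/-- The scaled second weight `g = 2d/(B_d λ)`: `g ≥ 0`, `g = √(2d)/(√(2d+1)+1)`, and `g ≤ g⁺/ONE` (`d ≥ 3`). -/
theorem gr_facts {d : ℕ} (hd : 3 ≤ d) :
    0 ≤ gr d ∧ gr d = √(2 * (d : ℝ)) / (√(2 * (d : ℝ) + 1) + 1) ∧ gr d ≤ (gU d : ℝ) / ONE := by
  have hg0 : 0 ≤ gr d := by
    unfold gr
    exact div_nonneg (by positivity) (mul_nonneg (hermiteTestBound_pos d).le (Real.sqrt_nonneg _))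
  have hgeq : gr d = √(2 * (d : ℝ)) / (√(2 * (d : ℝ) + 1) + 1) := by
    unfold gr hermiteTestBound
    have hl := (lam_facts hd).1
    have hs : 0 < √(2 * (d : ℝ) + 1) + 1 := by positivity
    rw [div_eq_div_iff (mul_pos (by positivity) hl).ne' hs.ne']
    have := sqrt_two_d_mul_lam d
    nlinarith [this]
  refine ⟨hg0, hgeq, ?_⟩
  rw [hgeq]
  unfold gU
  have hnum : √(2 * (d : ℝ)) ≤ (sqrtU (2 * d * ONE) : ℝ) / ONE := by
    apply sqrtU_ge; push_cast; rw [mul_div_assoc, div_self ONE_facts.2.1, mul_one]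
  have hden : ((sqrtD ((2 * d + 1) * ONE) : ℝ) + ONE) / ONE ≤ √(2 * (d : ℝ) + 1) + 1 := by
    rw [add_div, div_self ONE_facts.2.1]
    have := sqrtD_le ((2 * d + 1) * ONE)
    push_cast at this
    rw [mul_div_assoc, div_self ONE_facts.2.1, mul_one] at this
    linarith
  have hdenpos : (0 : ℝ) < ((sqrtD ((2 * d + 1) * ONE) : ℝ) + ONE) / ONE := by
    have := ONE_facts.1; positivity
  have hc := div_le_cdiv (sqrtU (2 * d * ONE) * ONE) (sqrtD ((2 * d + 1) * ONE) + ONE)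
    (by have := ONE_facts.2.2; positivity)
  calc √(2 * (d : ℝ)) / (√(2 * (d : ℝ) + 1) + 1)
      ≤ ((sqrtU (2 * d * ONE) : ℝ) / ONE) / (((sqrtD ((2 * d + 1) * ONE) : ℝ) + ONE) / ONE) :=
        div_le_div₀ (fp_nonneg _) hnum hdenpos hden
    _ = ((sqrtU (2 * d * ONE) * ONE : ℕ) : ℝ) / ((sqrtD ((2 * d + 1) * ONE) + ONE : ℕ) : ℝ) / ONE := by
        have hO : (ONE : ℝ) ≠ 0 := ONE_facts.2.1
        push_cast; field_simp
    _ ≤ _ := div_le_div_of_nonneg_right hc ONE_facts.1.le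

/-- Term identity for the second sum: `(d)_j e_j (2/B_d)^j = P_j g^j ẽ_j`. -/
theorem term2_eq {d : ℕ} (hd : 3 ≤ d) (j : ℕ) :
    (d.descFactorial j : ℝ) * cumulantCoeff (capFun d) j * (2 / hermiteTestBound d) ^ j
      = Pr d j * gr d ^ j * et d j := by
  unfold Pr gr et
  have hl : lam d ≠ 0 := ((lam_facts hd).1).ne'
  have hB : hermiteTestBound d ≠ 0 := (hermiteTestBound_pos d).ne'
  have hd0 : (d : ℝ) ≠ 0 := by
    have : (3:ℝ) ≤ d := by exact_mod_cast hd
    linarith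
  rw [div_pow, div_pow, mul_pow, mul_pow]
  field_simp




open Finset Real
open Summit.RiemannHypothesis.RiemannHypothesis.Theorems.JensenPolynomials

/-- The first sum is dominated by `S₁⁺/ONE`. -/
theorem sum1_le (d : ℕ) (hd : 3 ≤ d) (hyp : ypOf (xU d) < ONE)
    (hB : BKof (btListx d (xU d)) + Tof d (xU d) ≤ 3 * ONE)
    (hBK : BKof (btListx d (xU d)) < (JJ + 1) * ONE) :
    ∑ j ∈ range d, (d.descFactorial (j + 1) : ℝ) * cumulantCoeff (capFun d) (j + 1) * rhoWinMin d (j + 1)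
      ≤ (S1of d (sqdU d) (r3U d)
          (etaOf (etTab (btListx d (xU d)) (Tof d (xU d)) (Jd d)) (Tof d (xU d)) (BKof (btListx d (xU d))))
          (etTab (btListx d (xU d)) (Tof d (xU d)) (Jd d)) : ℝ) / ONE := by
  have hetU := et_le_etU d hyp hB
  have heta : JJ < d → ∀ i, JJ - KK < i → et d i ≤
      (etaOf (etTab (btListx d (xU d)) (Tof d (xU d)) (Jd d)) (Tof d (xU d)) (BKof (btListx d (xU d))) : ℝ) / ONE :=
    fun hJ => et_le_eta d hyp hB hBK hJ
  clear hyp hB hBK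
  generalize btListx d (xU d) = bts at *
  generalize Tof d (xU d) = T at *
  generalize BKof bts = BK at *
  generalize etaOf (etTab bts T (Jd d)) T BK = eta at *
  have hJd : Jd d ≤ d := min_le_left _ _
  rw [Finset.sum_congr rfl (fun j _ => term1_eq hd (j + 1)), ← Finset.sum_range_add_sum_Ico _ hJd]
  unfold S1of
  push_cast
  rw [add_div, Finset.sum_div]
  apply add_le_add
  · apply Finset.sum_le_sum
    intro j hj
    rw [Finset.mem_range] at hj
    rw [etTab_getD bts T (Jd d) (Jd d - (j + 1)) (by omega), show Jd d - (Jd d - (j + 1)) = j + 1 by omega]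
    exact mulU_ge ((W1r_nonneg hd (by omega)).1) ((et_nonneg d _).1) (W1r_le hd (by omega) (by omega)) (hetU (j + 1))
  · by_cases hJ : JJ < d
    · rw [if_pos hJ]
      have hJd' : Jd d = JJ := min_eq_right hJ.le
      rw [hJd']
      have hb : ∀ j ∈ Ico JJ d, W1r d (j + 1) * et d (j + 1) ≤ ((WmaxOf d (sqdU d) : ℝ) / ONE) * ((eta : ℝ) / ONE) := by
        intro j hj
        rw [Finset.mem_Ico] at hj
        exact mul_le_mul (W1r_le_max hd (by have := KKJJ_val; omega) (by omega))
          (heta hJ (j + 1) (by omega)) ((et_nonneg d _).1) (fp_nonneg _)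
      refine (Finset.sum_le_sum hb).trans ?_
      rw [Finset.sum_const, Nat.card_Ico, nsmul_eq_mul]
      have h := mulU_ge (a := eta * (d - JJ)) (b := WmaxOf d (sqdU d)) (u := (eta : ℝ) / ONE * ((d - JJ : ℕ) : ℝ))
        (v := (WmaxOf d (sqdU d) : ℝ) / ONE) (mul_nonneg (fp_nonneg _) (Nat.cast_nonneg _)) (fp_nonneg _)
        (by push_cast; rw [div_mul_eq_mul_div]) le_rfl
      calc ((d - JJ : ℕ) : ℝ) * ((WmaxOf d (sqdU d) : ℝ) / ONE * ((eta : ℝ) / ONE))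
          = (eta : ℝ) / ONE * ((d - JJ : ℕ) : ℝ) * ((WmaxOf d (sqdU d) : ℝ) / ONE) := by ring
        _ ≤ _ := h
    · rw [if_neg hJ]
      have hJd' : Jd d = d := min_eq_left (not_lt.mp hJ)
      rw [hJd', Finset.Ico_self, Finset.sum_empty]
      simp

/-- The second sum is dominated by `S₂⁺/ONE`. -/
theorem sum2_le (d : ℕ) (hd : 3 ≤ d) (hyp : ypOf (xU d) < ONE)
    (hB : BKof (btListx d (xU d)) + Tof d (xU d) ≤ 3 * ONE)
    (hBK : BKof (btListx d (xU d)) < (JJ + 1) * ONE) (hg : gU d < ONE) :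
    ∑ j ∈ range d, (d.descFactorial (j + 1) : ℝ) * cumulantCoeff (capFun d) (j + 1) * (2 / hermiteTestBound d) ^ (j + 1)
      ≤ (S2of d (gU d)
          (etaOf (etTab (btListx d (xU d)) (Tof d (xU d)) (Jd d)) (Tof d (xU d)) (BKof (btListx d (xU d))))
          (etTab (btListx d (xU d)) (Tof d (xU d)) (Jd d)) : ℝ) / ONE := by
  have hd0 : 0 < d := by omega
  have hetU := et_le_etU d hyp hB
  have heta : JJ < d → ∀ i, JJ - KK < i → et d i ≤
      (etaOf (etTab (btListx d (xU d)) (Tof d (xU d)) (Jd d)) (Tof d (xU d)) (BKof (btListx d (xU d))) : ℝ) / ONE :=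
    fun hJ => et_le_eta d hyp hB hBK hJ
  have hgle := (gr_facts hd).2.2
  have hg1 : gr d ≤ 1 := by
    have : (gU d : ℝ) / ONE < 1 := by rw [div_lt_one ONE_facts.1]; exact_mod_cast hg
    linarith
  have hg0 := (gr_facts hd).1
  clear hyp hB hBK hg
  generalize btListx d (xU d) = bts at *
  generalize Tof d (xU d) = T at *
  generalize BKof bts = BK at *
  generalize etaOf (etTab bts T (Jd d)) T BK = eta at *
  generalize gU d = g at *
  have hJd : Jd d ≤ d := min_le_left _ _
  rw [Finset.sum_congr rfl (fun j _ => term2_eq hd (j + 1)), ← Finset.sum_range_add_sum_Ico _ hJd]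
  unfold S2of
  push_cast
  rw [add_div, Finset.sum_div]
  apply add_le_add
  · apply Finset.sum_le_sum
    intro j hj
    rw [Finset.mem_range] at hj
    rw [etTab_getD bts T (Jd d) (Jd d - (j + 1)) (by omega), show Jd d - (Jd d - (j + 1)) = j + 1 by omega]
    exact mulU_ge (mul_nonneg ((Pr_facts hd0 _).1) (pow_nonneg hg0 _)) ((et_nonneg d _).1)
      (mulU_ge ((Pr_facts hd0 _).1) (pow_nonneg hg0 _) (Pr_le_PU hd0 (j + 1) (by omega)) (powU_ge hg0 hgle _))
      (hetU (j + 1))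
  · by_cases hJ : JJ < d
    · rw [if_pos hJ]
      have hJd' : Jd d = JJ := min_eq_right hJ.le
      rw [hJd']
      have hb : ∀ j ∈ Ico JJ d, Pr d (j + 1) * gr d ^ (j + 1) * et d (j + 1) ≤ (eta : ℝ) / ONE := by
        intro j hj
        rw [Finset.mem_Ico] at hj
        have h1 : Pr d (j + 1) * gr d ^ (j + 1) ≤ 1 := by
          calc Pr d (j + 1) * gr d ^ (j + 1) ≤ 1 * 1 :=
                mul_le_mul ((Pr_facts hd0 _).2) (pow_le_one₀ hg0 hg1) (pow_nonneg hg0 _) zero_le_one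
            _ = 1 := one_mul 1
        have h2 := heta hJ (j + 1) (by omega)
        calc Pr d (j + 1) * gr d ^ (j + 1) * et d (j + 1) ≤ 1 * et d (j + 1) :=
              mul_le_mul_of_nonneg_right h1 ((et_nonneg d _).1)
          _ ≤ (eta : ℝ) / ONE := by rw [one_mul]; exact h2
      refine (Finset.sum_le_sum hb).trans ?_
      rw [Finset.sum_const, Nat.card_Ico, nsmul_eq_mul]
      apply le_of_eq; ring
    · rw [if_neg hJ]
      have hJd' : Jd d = d := min_eq_left (not_lt.mp hJ)
      rw [hJd', Finset.Ico_self, Finset.sum_empty]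
      simp

/-- **SOUNDNESS OF THE CHECKER: `capCheck d = true` ⇒ both inequalities of `XiCumulantMajorantCap` at degree `d`
(stated with the cap sequence written exactly as in the route item).** -/
theorem capCheck_sound (d : ℕ) (h : capCheck d = true) :
    (∑ j ∈ Finset.range d, (d.descFactorial (j + 1) : ℝ) *
        cumulantCoeff (fun k : ℕ => (if k ≤ 3 then (9 / 8 : ℝ) else (k : ℝ) * 4 ^ (k - 3) / 3) *
          (Nat.factorial (k - 1) : ℝ) * (2 : ℝ) ^ ((k : ℝ) / 2) /
            ((max 10000 (2 * d ^ 3) + d : ℕ) : ℝ) ^ (((k : ℝ) - 2) / 2)) (j + 1) * rhoWinMin d (j + 1) < 1) ∧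
    (∑ j ∈ Finset.range d, (d.descFactorial (j + 1) : ℝ) *
        cumulantCoeff (fun k : ℕ => (if k ≤ 3 then (9 / 8 : ℝ) else (k : ℝ) * 4 ^ (k - 3) / 3) *
          (Nat.factorial (k - 1) : ℝ) * (2 : ℝ) ^ ((k : ℝ) / 2) /
            ((max 10000 (2 * d ^ 3) + d : ℕ) : ℝ) ^ (((k : ℝ) - 2) / 2)) (j + 1) *
          (2 / hermiteTestBound d) ^ (j + 1) < 1) := by
  unfold capCheck at h
  simp only [Bool.and_eq_true, decide_eq_true_eq] at h
  obtain ⟨⟨⟨⟨⟨⟨hd, hyp⟩, hB⟩, hBK⟩, hg⟩, hS1⟩, hS2⟩ := h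
  have h1 := sum1_le d hd hyp hB hBK
  have h2 := sum2_le d hd hyp hB hBK hg
  have hS1' : (S1of d (sqdU d) (r3U d)
      (etaOf (etTab (btListx d (xU d)) (Tof d (xU d)) (Jd d)) (Tof d (xU d)) (BKof (btListx d (xU d))))
      (etTab (btListx d (xU d)) (Tof d (xU d)) (Jd d)) : ℝ) / ONE < 1 := by
    rw [div_lt_one ONE_facts.1]; exact_mod_cast hS1
  have hS2' : (S2of d (gU d)
      (etaOf (etTab (btListx d (xU d)) (Tof d (xU d)) (Jd d)) (Tof d (xU d)) (BKof (btListx d (xU d))))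
      (etTab (btListx d (xU d)) (Tof d (xU d)) (Jd d)) : ℝ) / ONE < 1 := by
    rw [div_lt_one ONE_facts.1]; exact_mod_cast hS2
  exact ⟨h1.trans_lt hS1', h2.trans_lt hS2'⟩

/-- Soundness over a range: `capCheckRange a n = true` ⇒ the inequalities for every `a ≤ d < a + n`. -/
theorem capCheckRange_sound {a n : ℕ} (h : capCheckRange a n = true) {d : ℕ} (h1 : a ≤ d) (h2 : d < a + n) :
    (∑ j ∈ Finset.range d, (d.descFactorial (j + 1) : ℝ) *
        cumulantCoeff (fun k : ℕ => (if k ≤ 3 then (9 / 8 : ℝ) else (k : ℝ) * 4 ^ (k - 3) / 3) *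
          (Nat.factorial (k - 1) : ℝ) * (2 : ℝ) ^ ((k : ℝ) / 2) /
            ((max 10000 (2 * d ^ 3) + d : ℕ) : ℝ) ^ (((k : ℝ) - 2) / 2)) (j + 1) * rhoWinMin d (j + 1) < 1) ∧
    (∑ j ∈ Finset.range d, (d.descFactorial (j + 1) : ℝ) *
        cumulantCoeff (fun k : ℕ => (if k ≤ 3 then (9 / 8 : ℝ) else (k : ℝ) * 4 ^ (k - 3) / 3) *
          (Nat.factorial (k - 1) : ℝ) * (2 : ℝ) ^ ((k : ℝ) / 2) /
            ((max 10000 (2 * d ^ 3) + d : ℕ) : ℝ) ^ (((k : ℝ) - 2) / 2)) (j + 1) *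
          (2 / hermiteTestBound d) ^ (j + 1) < 1) := by
  apply capCheck_sound
  unfold capCheckRange at h
  rw [List.all_eq_true] at h
  have := h (d - a) (List.mem_range.mpr (by omega))
  rwa [show a + (d - a) = d by omega] at this

end Summit.RiemannHypothesis.RiemannHypothesis.Theorems.JensenPolynomials.CapCert
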